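import Summits.BirchSwinnertonDyer.BirchSwinnertonDyer.Theorems.ByReductionTypeAtTwoAdditiveKatoTransportDescentGammaTwist
import Summits.BirchSwinnertonDyer.BirchSwinnertonDyer.Theorems.ByReductionTypeAtTwoAdditiveKatoTransportDescentDoors
import Summits.BirchSwinnertonDyer.BirchSwinnertonDyer.Theorems.ByReductionTypeAtTwoAdditiveKatoTransportPrintExactAnyImageFinalDoors
import HarnessLib

/-!
# Route ByReductionTypeAtTwo, crux C4″ `AdditivePotMultOverKAtTwo` (stmt-BirchSwinnertonDyer-22618; parent
# `AdditiveRankZeroAtTwo` 19098) — the (−2)-SPLIT-TWIST block's base doors (key `γ⁻¹` length form, key-`γ` torsion) keyed by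
# the Literature CONSTRUCTION fact `Kato2004.exists_splitTwistDivisibilityInputsDescent_negOne_two`, for EVERY generator
# (the normalisation `κ_cyc(γ) = 5` performed as a WLOG inside; theorems only)

Cell `bsd-2adic` (run/shared/lean/pub/bsd-2adic/), seat `bsd-2adic-k4-w3` GEN 8 (explicit unit of director-bsd g16 (309)(7);
successor road R-B80 (1) of addL2x GEN 17). The (−2)-block twin of addL2x GEN 17's `…AdditiveKatoTransportDescentDoors.lean`,
fed by this seat's `AddKatoTwoGammaTwist.exists_splitTwistDescent_negTwo_two_of_negOne` («(−1) Literature fact ⟹ (−2) descent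
package» — R15 on the descent package, file `…DescentGammaTwist.lean`): from the package at `(W, 5T+6, L⁻_2(f,1,ωχ₂))` the END
statements are the Literature theorems `Kato2004.SplitTwistDivisibilityInputsDescent.lengthAt_X_le_off_theta` /
`…at_theta_of_lengthAt_symm` / `….isTorsion_X` (generic in `(θ, L)`, addL2x p725170), the prime dichotomy
`not_mem_comap_invol_of_mem_five_X_add_six` (`ι(5T+6) ≐ T+6`) and the twisted functional equation
`MultOddBranchFE.map_invol_span_eq_of_eq_oddBranchMultTwist_two_of_split` (t42 GEN 21).

ONE DESIGN POINT (why the WLOG sits at the base level here, not at the final level as in the (−1) chain). The Literature fact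
is normalised at Kato's generator, `κ_cyc(γ) = 5`, and that normalisation passes unchanged through R15 to the (−2) package. But
`κ_cyc(γ) = 5` means `γ(ζ₈) = ζ₈⁵ = −ζ₈`, hence `γ(√−1) = √−1` while **`γ(√−2) = −√−2`** (`√−2 = ζ₈ + ζ₈³`): the (−1)-block's
model door over `ℚ(√−1)` (binder `γ·θ = θ`) is compatible with the normalisation, the (−2)-block's model door over `ℚ(√−2)`
is NOT (it forces `κ_cyc(γ) = −5`). So the (−2) chain must decouple the two generators: the doors of this file hold for EVERY
`γ` matching the cyclotomic variable (`κ_cyc(γ) = ±5`); inside, `c ∈ ker κ` with `κ_cyc(γ·c) = 5` (addL2x's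
`exists_mem_kerSubgroup_cyclotomicCharacter_mul_eq_five`: `c = 1` or a complex conjugation), the package at `γ·c` for
`I = 𝐇¹_Γ(T₂W)` SUPPLIED there (`Kato2004.nonempty_iwasawaH1Data_holds`), and the re-keying `SelmerDualData.rekey` (`ℚ_∞`-objects
do not see `c`; same module — §0 carries the two length/torsion clauses across `γ·c ↦ γ` and `(γ·c)⁻¹ ↦ γ⁻¹`). Above this
file the (−2) chain (companion `…DescentNegTwoFinalDoors.lean`: Decomposition / Model over `ℚ(√−2)` / Print / Final) is the
cell's GEN 4–6 (−2) chain with `hPE ↦ hDesc` and the `I`-binder dropped.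

Contents:
* §0 `forall_selmerDualData_symm_of_rekey` / `…_of_eq` / `…_inv_of_mul`, `forall_selmerDualData_isTorsion_of_rekey` — re-keying
  of the length clause WITH the `ι`-symmetry premise, and of the torsion clause.
* §1 **`lengthAt_selmerDualContra_le_of_splitTwistDescent_negTwo_of_lengthAt_symm_fe`** — `ℓ_𝔮(X') ≤ ℓ_𝔮(Λ/(L̃))` at a
  height-one `𝔮 ∌ 2` with `ℓ_𝔮(X') = ℓ_{ι𝔮}(X')`, for every key-`γ⁻¹` datum of `W` (additive, `W^{(−2)}` split multiplicative
  at `2`), `L̃ = 2^m·L⁻_2(f,1,ωχ₂) ≠ 0`, EVERY generator.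
* §2 torsion, every generator: `isTorsion_selmerDual_of_splitTwistDescent_negTwo{,_of_doorMultiple,_of_isIsogenous}`.

HONEST FRAMING (D-0036 / D-0054): theorems only — no definition, no named fact, no instance, no `sorry`; route-independent;
CONDITIONAL on `Kato2004.thm12_4` (PRINT) and the Literature construction fact
`Kato2004.exists_splitTwistDivisibilityInputsDescent_negOne_two` (review-accepted p724228; D-0026 debt of addL2x) BY NAME;
types-the-object-of (the (−2)-split sub-block's ONE typed input @2 — the Summits `@[conjecture]` constant — is superseded by
the (−1) Literature construction fact + KERNEL, as for the (−1)-block); closes none; nothing booked; BSD is not proved by any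
of this. PARTITION: X5@2 additive potentially-multiplicative block, the (−2)-split sub-block (39 classes; 30 irreducible,
9 reducible) × `p = 2`.

References: [Kato2004Asterisque] Thm. 12.4 (2) (p. 221), Thm. 12.5 (3) with (12.5.1) (p. 222), Thm. 17.4 (1) (p. 273), §17.13
(pp. 279–280); [GreenbergLNM1716] §1 (p. 60), Thm. 1.14 (p. 68), §4 (p. 107); [Greenberg1989] pp. 101–102;
[MazurTateTeitelbaum1986Invent] §I.13, §I.17; [Washington1997] §13.1; [GreenbergVatsal2000] §2 (p. 28); memos
`run/shared/lean/pub/bsd-2adic/k4w3/gen8/VERDICT-22618-k4w3-GEN8.md`, `…/addL2x/VERDICT-19098-addL2x-GEN17.md`.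
-/

set_option autoImplicit false
-- the summit's namespace `Summit.BirchSwinnertonDyer.BirchSwinnertonDyer` (Sub = Summit) trips `dupNamespace`
set_option linter.dupNamespace false

noncomputable section

open scoped Classical MatrixGroups ModularForm

open Field CongruenceSubgroup WeierstrassCurve Literature.NumberTheory.EllipticCurves
  Literature.NumberTheory.EllipticCurves.ModularForms Literature.NumberTheory.EllipticCurves.IwasawaAlgebra
  Literature.NumberTheory.EllipticCurves.Module Literature.NumberTheory.GaloisRepresentations

namespace Summit.BirchSwinnertonDyer.BirchSwinnertonDyer.Theorems.AddKatoTwo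

/-! ## §0 Re-keying the clauses along `ker κ` -/

section Rekey

variable {κ : ZpExtension ℚ 2} {W₀ : WeierstrassCurve ℚ} (Lt : IwasawaAlgebra 2)

/-- The length clause WITH the `ι`-symmetry premise, quantified over the dual Selmer data keyed `γ·c` (`c ∈ ker κ`), gives the
clause keyed `γ`: `D ↦ D.rekey` has the SAME module (`SelmerDualData.rekey_X`). [cite: GreenbergLNM1716, §1 (p. 60)] -/
theorem forall_selmerDualData_symm_of_rekey {γ c : absoluteGaloisGroup ℚ} (hc : c ∈ κ.kerSubgroup)
    (h : ∀ (D : W₀.SelmerDualData κ (γ * c)) (𝔮 : PrimeSpectrum (IwasawaAlgebra 2)), 𝔮.asIdeal.height = 1 →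
      PowerSeries.C (2 : ℤ_[2]) ∉ 𝔮.asIdeal →
      lengthAt (IwasawaAlgebra 2) D.X 𝔮 = lengthAt (IwasawaAlgebra 2) D.X (PrimeSpectrum.comap (invol 2).toRingHom 𝔮) →
      lengthAt (IwasawaAlgebra 2) D.X 𝔮 ≤ lengthAt (IwasawaAlgebra 2) (IwasawaAlgebra 2 ⧸ Ideal.span {Lt}) 𝔮) :
    ∀ (D : W₀.SelmerDualData κ γ) (𝔮 : PrimeSpectrum (IwasawaAlgebra 2)), 𝔮.asIdeal.height = 1 →
      PowerSeries.C (2 : ℤ_[2]) ∉ 𝔮.asIdeal →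
      lengthAt (IwasawaAlgebra 2) D.X 𝔮 = lengthAt (IwasawaAlgebra 2) D.X (PrimeSpectrum.comap (invol 2).toRingHom 𝔮) →
      lengthAt (IwasawaAlgebra 2) D.X 𝔮 ≤ lengthAt (IwasawaAlgebra 2) (IwasawaAlgebra 2 ⧸ Ideal.span {Lt}) 𝔮 :=
  fun D 𝔮 h𝔮 hp𝔮 hs ↦ h (D.rekey hc) 𝔮 h𝔮 hp𝔮 hs

/-- Transport of the length clause with symmetry premise along equal keys. [folklore] -/
theorem forall_selmerDualData_symm_of_eq {γ₁ γ₂ : absoluteGaloisGroup ℚ} (e : γ₁ = γ₂)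
    (h : ∀ (D : W₀.SelmerDualData κ γ₁) (𝔮 : PrimeSpectrum (IwasawaAlgebra 2)), 𝔮.asIdeal.height = 1 →
      PowerSeries.C (2 : ℤ_[2]) ∉ 𝔮.asIdeal →
      lengthAt (IwasawaAlgebra 2) D.X 𝔮 = lengthAt (IwasawaAlgebra 2) D.X (PrimeSpectrum.comap (invol 2).toRingHom 𝔮) →
      lengthAt (IwasawaAlgebra 2) D.X 𝔮 ≤ lengthAt (IwasawaAlgebra 2) (IwasawaAlgebra 2 ⧸ Ideal.span {Lt}) 𝔮) :
    ∀ (D : W₀.SelmerDualData κ γ₂) (𝔮 : PrimeSpectrum (IwasawaAlgebra 2)), 𝔮.asIdeal.height = 1 →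
      PowerSeries.C (2 : ℤ_[2]) ∉ 𝔮.asIdeal →
      lengthAt (IwasawaAlgebra 2) D.X 𝔮 = lengthAt (IwasawaAlgebra 2) D.X (PrimeSpectrum.comap (invol 2).toRingHom 𝔮) →
      lengthAt (IwasawaAlgebra 2) D.X 𝔮 ≤ lengthAt (IwasawaAlgebra 2) (IwasawaAlgebra 2 ⧸ Ideal.span {Lt}) 𝔮 := by
  subst e
  exact h

/-- The key-`γ⁻¹` clause (with symmetry premise) from the key-`(γc)⁻¹` clause (`c ∈ ker κ`): `(γc)⁻¹ = γ⁻¹·(γ c⁻¹ γ⁻¹)` with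
`γ c⁻¹ γ⁻¹ ∈ ker κ` (normal subgroup), then re-key. [cite: GreenbergLNM1716, §1 (p. 60)] -/
theorem forall_selmerDualData_symm_inv_of_mul {γ c : absoluteGaloisGroup ℚ} (hc : c ∈ κ.kerSubgroup)
    (h : ∀ (D : W₀.SelmerDualData κ (γ * c)⁻¹) (𝔮 : PrimeSpectrum (IwasawaAlgebra 2)), 𝔮.asIdeal.height = 1 →
      PowerSeries.C (2 : ℤ_[2]) ∉ 𝔮.asIdeal →
      lengthAt (IwasawaAlgebra 2) D.X 𝔮 = lengthAt (IwasawaAlgebra 2) D.X (PrimeSpectrum.comap (invol 2).toRingHom 𝔮) →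
      lengthAt (IwasawaAlgebra 2) D.X 𝔮 ≤ lengthAt (IwasawaAlgebra 2) (IwasawaAlgebra 2 ⧸ Ideal.span {Lt}) 𝔮) :
    ∀ (D : W₀.SelmerDualData κ γ⁻¹) (𝔮 : PrimeSpectrum (IwasawaAlgebra 2)), 𝔮.asIdeal.height = 1 →
      PowerSeries.C (2 : ℤ_[2]) ∉ 𝔮.asIdeal →
      lengthAt (IwasawaAlgebra 2) D.X 𝔮 = lengthAt (IwasawaAlgebra 2) D.X (PrimeSpectrum.comap (invol 2).toRingHom 𝔮) →
      lengthAt (IwasawaAlgebra 2) D.X 𝔮 ≤ lengthAt (IwasawaAlgebra 2) (IwasawaAlgebra 2 ⧸ Ideal.span {Lt}) 𝔮 := by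
  have hg : γ * c⁻¹ * γ⁻¹ ∈ κ.kerSubgroup := (ZpExtension.kerSubgroup_normal κ).conj_mem _ (inv_mem hc) γ
  have e : (γ * c)⁻¹ = γ⁻¹ * (γ * c⁻¹ * γ⁻¹) := by group
  exact forall_selmerDualData_symm_of_rekey Lt hg (forall_selmerDualData_symm_of_eq Lt e h)

/-- The torsion clause quantified over the dual Selmer data keyed `γ·c` (`c ∈ ker κ`) gives the clause keyed `γ` (`D.rekey`
has the same module). [cite: GreenbergLNM1716, §1 (p. 60)] -/
theorem forall_selmerDualData_isTorsion_of_rekey {γ c : absoluteGaloisGroup ℚ} (hc : c ∈ κ.kerSubgroup)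
    (h : ∀ D : W₀.SelmerDualData κ (γ * c), D.IsTorsion) : ∀ D : W₀.SelmerDualData κ γ, D.IsTorsion :=
  fun D ↦ h (D.rekey hc)

end Rekey

/-! ## §1 The (−2)-block, key `γ⁻¹`, length form, EVERY generator -/

/-- **`ℓ_𝔮(X') ≤ ℓ_𝔮(Λ/(L̃))` for the key-`γ⁻¹` dual Selmer datum `D'` of `W` (additive at `2`, `W^{(−2)}` split multiplicative),
at a height-one `𝔮 ∌ 2` where `ℓ_𝔮(X') = ℓ_{ι𝔮}(X')`, EVERY generator `γ` matching the cyclotomic variable, functional equation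
in the kernel — keyed by the (−1) Literature CONSTRUCTION fact.** From `Kato2004.thm12_4` (PRINT),
`Kato2004.exists_splitTwistDivisibilityInputsDescent_negOne_two` and an integral multiple `L̃ = 2^m·L⁻_2(f,1,ωχ₂) ≠ 0` of the
`χ₂`-twisted odd branch. Proof: `c ∈ ker κ` with `κ_cyc(γc) = 5`; at `γc` the (−2) descent package
(`AddKatoTwoGammaTwist.exists_splitTwistDescent_negTwo_two_of_negOne`, `I` SUPPLIED) gives the bound off `(5T+6)`
(`….lengthAt_X_le_off_theta`) and at it by transport from `ι(5T+6) ≐ T+6` (`….lengthAt_X_le_at_theta_of_lengthAt_symm`, twisted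
FE `MultOddBranchFE.map_invol_span_eq_of_eq_oddBranchMultTwist_two_of_split`); then re-key `(γc)⁻¹ ↦ γ⁻¹` (§0). (−2)-twin of
addL2x's `lengthAt_selmerDualContra_le_of_splitTwistDescent_of_lengthAt_symm_fe`, every generator.
[cite: Kato2004Asterisque, Thm. 12.4 (2) (p. 221), Thm. 12.5 (3) and (12.5.1) (p. 222), Conj. 17.6 (p. 274), §17.13 (pp. 279–280)]
[cite: GreenbergLNM1716, §1 (p. 60), Thm. 1.14 (p. 68), §4 (p. 107)] [cite: MazurTateTeitelbaum1986Invent, §I.13, §I.17]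
[cite: Washington1997, §13.1] -/
theorem lengthAt_selmerDualContra_le_of_splitTwistDescent_negTwo_of_lengthAt_symm_fe
    (hDesc : Kato2004.exists_splitTwistDivisibilityInputsDescent_negOne_two) (h12 : Kato2004.thm12_4)
    (W : WeierstrassCurve ℚ) [W.IsElliptic] [W.IsGloballyMinimal] [ContinuousSMul ℤ_[2] (W.tateModule 2)]
    {N : ℕ} [NeZero N] (f : CuspForm (Gamma0 N) 2) (κ : ZpExtension ℚ 2) (γ : absoluteGaloisGroup ℚ)
    (hsp : (W.quadraticTwist (-2)).HasSplitMultiplicativeReductionAtPrime 2)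
    (hκ : κ.IsCyclotomic) (hγ : κ.IsTopGenerator γ) (hγ' : IsCyclotomicVariable 2 γ)
    (hf : IsNewformOf (W.quadraticTwist (-2)) f)
    (D' : W.SelmerDualData κ γ⁻¹) (Lt : IwasawaAlgebra 2) (m : ℕ)
    (hLt : iwasawaToPowerSeries 2 Lt =
      PowerSeries.C ((2 : ℚ_[2]) ^ m) * padicLFunctionMinusBranchMultTwist f (1 : ℚ_[2]) 1 (-1))
    (hLt0 : Lt ≠ 0)
    (𝔮 : PrimeSpectrum (IwasawaAlgebra 2)) (h𝔮 : 𝔮.asIdeal.height = 1)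
    (hp𝔮 : PowerSeries.C (2 : ℤ_[2]) ∉ 𝔮.asIdeal)
    (hXsym : lengthAt (IwasawaAlgebra 2) D'.X 𝔮 =
      lengthAt (IwasawaAlgebra 2) D'.X (PrimeSpectrum.comap (invol 2).toRingHom 𝔮)) :
    lengthAt (IwasawaAlgebra 2) D'.X 𝔮 ≤
      lengthAt (IwasawaAlgebra 2) (IwasawaAlgebra 2 ⧸ Ideal.span {Lt}) 𝔮 := by
  haveI : Fact (Nat.Prime 2) := ⟨Nat.prime_two⟩
  -- WLOG `κ_cyc(γc) = 5`, `c ∈ ker κ`; the pin `𝐇¹_Γ(T₂W)` at `γc`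
  obtain ⟨c, hc, hγc5⟩ := exists_mem_kerSubgroup_cyclotomicCharacter_mul_eq_five κ hγ'
  have hγc : κ.IsTopGenerator (γ * c) := isTopGenerator_mul_of_mem_kerSubgroup κ hγ hc
  obtain ⟨I⟩ := Kato2004.nonempty_iwasawaH1Data_holds W 2 κ (γ * c) hκ hγc
  have hLtι : (Ideal.span {Lt}).map (invol 2).toRingHom = Ideal.span {Lt} :=
    MultOddBranchFE.map_invol_span_eq_of_eq_oddBranchMultTwist_two_of_split hsp hf hLt
  have hp2 : ((2 : ℕ) : ℚ_[2]) = (2 : ℚ_[2]) := by norm_num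
  have hLt' : iwasawaToPowerSeries 2 Lt =
      PowerSeries.C (((2 : ℕ) : ℚ_[2]) ^ m) * padicLFunctionMinusBranchMultTwist f (1 : ℚ_[2]) 1 (-1) := by
    rw [hp2]; exact hLt
  -- the clause at key `(γc)⁻¹`, from the (−2) descent package
  have key : ∀ (D₁ : W.SelmerDualData κ (γ * c)⁻¹) (𝔮₁ : PrimeSpectrum (IwasawaAlgebra 2)), 𝔮₁.asIdeal.height = 1 →
      PowerSeries.C (2 : ℤ_[2]) ∉ 𝔮₁.asIdeal →
      lengthAt (IwasawaAlgebra 2) D₁.X 𝔮₁ =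
        lengthAt (IwasawaAlgebra 2) D₁.X (PrimeSpectrum.comap (invol 2).toRingHom 𝔮₁) →
      lengthAt (IwasawaAlgebra 2) D₁.X 𝔮₁ ≤ lengthAt (IwasawaAlgebra 2) (IwasawaAlgebra 2 ⧸ Ideal.span {Lt}) 𝔮₁ := by
    intro D₁ 𝔮₁ h𝔮₁ hp𝔮₁ hs
    obtain ⟨K⟩ := AddKatoTwoGammaTwist.exists_splitTwistDescent_negTwo_two_of_negOne hDesc W f κ (γ * c) hsp hκ hγc hγc5
      hf I D₁
    have hp𝔮₁' : PowerSeries.C ((2 : ℕ) : ℤ_[2]) ∉ 𝔮₁.asIdeal := by exact_mod_cast hp𝔮₁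
    rcases not_mem_comap_invol_of_mem_five_X_add_six 𝔮₁ hp𝔮₁ with hoff | hat
    · exact K.lengthAt_X_le_off_theta h12 hκ hγc hLt' hLt0 𝔮₁ h𝔮₁ hp𝔮₁' hoff
    · exact K.lengthAt_X_le_at_theta_of_lengthAt_symm h12 hκ hγc hLt' hLt0 𝔮₁ h𝔮₁ hp𝔮₁' hat hs hLtι
  exact forall_selmerDualData_symm_inv_of_mul Lt hc key D' 𝔮 h𝔮 hp𝔮 hXsym

/-! ## §2 The (−2)-block: `X(W/ℚ_∞)` is torsion, EVERY generator -/

section Torsion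

variable (W : WeierstrassCurve ℚ) [W.IsElliptic] [W.IsGloballyMinimal] [ContinuousSMul ℤ_[2] (W.tateModule 2)]
  {N : ℕ} [NeZero N] (f : CuspForm (Gamma0 N) 2) (κ : ZpExtension ℚ 2) (γ : absoluteGaloisGroup ℚ)
  (hsp : (W.quadraticTwist (-2)).HasSplitMultiplicativeReductionAtPrime 2)
  (hκ : κ.IsCyclotomic) (hγ : κ.IsTopGenerator γ) (hγ' : IsCyclotomicVariable 2 γ)
  (hf : IsNewformOf (W.quadraticTwist (-2)) f)

include hsp hκ hγ hγ' hf in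
/-- **`X(W/ℚ_∞)` of key `γ` is `Λ`-torsion for the additive (−2)-split-twist curve `W`, EVERY generator, from the (−1)
Literature fact and `L⁻_2(f,1,ωχ₂) ≠ 0`** (Thm. 17.4 (1) at `2` read through the (−2) descent package at `γc`, `κ_cyc(γc) = 5`:
`Kato2004.SplitTwistDivisibilityInputsDescent.isTorsion_X` on a key-`(γc)⁻¹` datum, carried to key `γc` by
`selmerDualData_isTorsion_of_inv` and to key `γ` by re-keying). (−2)-twin of addL2x's `isTorsion_selmerDual_of_splitTwistDescent`,
every generator. [cite: Kato2004Asterisque, Thm. 17.4 (1) (p. 273), §17.13 (pp. 279–280), 14.9 (p. 239)]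
[cite: GreenbergLNM1716, §1 (p. 60)] [cite: MazurTateTeitelbaum1986Invent, §I.13] -/
theorem isTorsion_selmerDual_of_splitTwistDescent_negTwo
    (hDesc : Kato2004.exists_splitTwistDivisibilityInputsDescent_negOne_two) (D : W.SelmerDualData κ γ)
    (hL : padicLFunctionMinusBranchMultTwist f (1 : ℚ_[2]) 1 (-1) ≠ 0) : D.IsTorsion := by
  haveI : Fact (Nat.Prime 2) := ⟨Nat.prime_two⟩
  obtain ⟨c, hc, hγc5⟩ := exists_mem_kerSubgroup_cyclotomicCharacter_mul_eq_five κ hγ'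
  have hγc : κ.IsTopGenerator (γ * c) := isTopGenerator_mul_of_mem_kerSubgroup κ hγ hc
  obtain ⟨I⟩ := Kato2004.nonempty_iwasawaH1Data_holds W 2 κ (γ * c) hκ hγc
  refine forall_selmerDualData_isTorsion_of_rekey hc (fun D₁ ↦ ?_) D
  obtain ⟨D', -, -, -⟩ := Kato2004.selmerDualData_exists_involTwist (mul_inv_cancel (γ * c)) D₁
  obtain ⟨K⟩ := AddKatoTwoGammaTwist.exists_splitTwistDescent_negTwo_two_of_negOne hDesc W f κ (γ * c) hsp hκ hγc hγc5
    hf I D'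
  exact selmerDualData_isTorsion_of_inv D' (K.isTorsion_X five_X_add_six_ne_zero hL) D₁

include hsp hκ hγ hγ' hf in
/-- Door-binder variant: an integral multiple `L̃ = 2^m·L⁻_2(f,1,ωχ₂) ≠ 0` replaces `L⁻_2(f,1,ωχ₂) ≠ 0`.
[cite: Kato2004Asterisque, Thm. 17.4 (1) (p. 273), Thm. 16.2 (p. 269)] -/
theorem isTorsion_selmerDual_of_splitTwistDescent_negTwo_of_doorMultiple
    (hDesc : Kato2004.exists_splitTwistDivisibilityInputsDescent_negOne_two) (D : W.SelmerDualData κ γ)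
    (Lt : IwasawaAlgebra 2) (m : ℕ)
    (hLt : iwasawaToPowerSeries 2 Lt =
      PowerSeries.C ((2 : ℚ_[2]) ^ m) * padicLFunctionMinusBranchMultTwist f (1 : ℚ_[2]) 1 (-1))
    (hLt0 : Lt ≠ 0) : D.IsTorsion := by
  refine isTorsion_selmerDual_of_splitTwistDescent_negTwo W f κ γ hsp hκ hγ hγ' hf hDesc D fun h0 ↦ hLt0 ?_
  haveI : Fact (Nat.Prime 2) := ⟨Nat.prime_two⟩
  apply iwasawaToPowerSeries_injective 2
  rw [hLt, h0, mul_zero, map_zero]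

include hsp hκ hγ hγ' hf in
/-- **Member form**: `X(W₁/ℚ_∞)` is `Λ`-torsion for every `W₁ ∼_ℚ W` (`IsogenyMuShift.isTorsion_of_isIsogenous`), `W` additive
(−2)-split-twist, from the (−1) Literature fact and `L⁻_2(f,1,ωχ₂) ≠ 0`, every generator.
[cite: Kato2004Asterisque, Thm. 17.4 (1) (p. 273), §8.3 (p. 181)] [cite: GreenbergVatsal2000, §2 (p. 28)] -/
theorem isTorsion_selmerDual_of_splitTwistDescent_negTwo_of_isIsogenous
    (hDesc : Kato2004.exists_splitTwistDivisibilityInputsDescent_negOne_two)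
    (hL : padicLFunctionMinusBranchMultTwist f (1 : ℚ_[2]) 1 (-1) ≠ 0) (W₁ : WeierstrassCurve ℚ) [W₁.IsElliptic]
    (hiso : IsIsogenous W W₁) (D₁ : W₁.SelmerDualData κ γ) : D₁.IsTorsion :=
  IsogenyMuShift.isTorsion_of_isIsogenous hiso (W.selmerDualData κ hγ) D₁
    (isTorsion_selmerDual_of_splitTwistDescent_negTwo W f κ γ hsp hκ hγ hγ' hf hDesc (W.selmerDualData κ hγ) hL)

end Torsion

end Summit.BirchSwinnertonDyer.BirchSwinnertonDyer.Theorems.AddKatoTwo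

end
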